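import Summits.KontsevichZagierPeriods.KontsevichZagierPeriods.Theses.TerasomaMultiplication
import Literature.NumberTheory.Transcendental.SemialgebraicRpow
import Literature.NumberTheory.Transcendental.SemialgebraicLineDeriv
import Literature.NumberTheory.Transcendental.KZLogCalculusProofs

/-!
# `MultiplicationAccessible` (stmt-KontsevichZagierPeriods-12305), line `shifted-family-prime-sieve`:
the general-`p` corner Stokes graph package, I — the division spelling of the graph density

Dimension `p = n + 2`. On the corner blow-up chart domain `U` (coordinates
`u = (θ₁, …, θ_{n+1}, y)`, `θ₀ = 1 − Σθ_i`, box coordinates `t_k = T u k = 1 − yΘ_k ∈ (0,1)`) the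
rotation-averaged shifted Gauss integrand
`G t = (Σ_j (∏_{i<j} t_i)/ζ^j)/p · ∏_k t_k^(x+k/p−1)(1 − t_k)^(s−1)`, `ζ = (∏ t)^(1/p)`, has the
division-free form `G t = (1/p)·Σ_j t_j^(x−1)∏_i t_{j+i+1}^(x+(i+1)/p−1) · ∏_k(1 − t_k)^(s−1)`
(cyclic indices; exponent book-keeping `CornerGraphGen.summand_eq`), whence the "division spelling"
of the graph density of the chart move:

  `G(T u)·y^(n+1) = (1/p)·y^(ps−1)·K u·Σ_k M u k / T u k`,  `0 < S u`,  `H u·(1 − Z u) = y`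

(`cornerGraphSpellingGen`, registered sub-goal; `K = (∏Θ)^(s−1)`,
`M u k = t_k^x ∏_i t_{k+i+1}^(x+(i+1)/p−1)`, `Z = ζ`, `y·S = 1 − ∏ t_k` (Vieta expansion of
`∏(1 − yΘ_k)`), `H = (Σ_{j<p} Z^j)/S`). The helper lemmas (namespace `CornerGraphGen`) are reused by
the sibling files (the `v`-derivative and the two representations). This is the dimension-`p`
version of `cornerGraphSpelling` (`p = 3`).
References: Kontsevich–Zagier 2001 §1.2; Andrews–Askey–Roy 1999 Thm 1.5.2 (Gauss multiplication).
-/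

noncomputable section

open MeasureTheory Set Real
open scoped BigOperators

namespace Summit.KontsevichZagierPeriods.TerasomaMultiplication.MultiplicationAccessible

namespace CornerGraphGen

/-- The value of a cyclic difference in `Fin m`, read in `ℝ`: `↑(k − j) = k − j + m·[k < j]`.
[folklore] -/
theorem natCast_val_sub {m : ℕ} (k j : Fin m) :
    (((k - j : Fin m) : ℕ) : ℝ) = (k:ℝ) - (j:ℝ) + if k < j then (m:ℝ) else 0 := by
  split_ifs with h
  · have hj := j.isLt
    rw [Fin.coe_sub_iff_lt.2 h, Nat.cast_sub (by omega), Nat.cast_add]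
    ring
  · rw [Fin.coe_sub_iff_le.2 (not_lt.1 h), Nat.cast_sub (not_lt.1 h), add_zero]

/-- **Exponent book-keeping for the `j`-th summand of the rotation average**: for positive `t`,
`(∏_{i<j} t_i)/ζ^j · ∏_k t_k^(x+k/p−1) = t_j^(x−1) · ∏_{i} t_{j+i+1}^(x+(i+1)/p−1)`
(`ζ = (∏ t)^(1/p)`, `p = n + 2`, cyclic indices: the exponent of `t_k` is
`x + (k − j)/p − 1 + [k < j]`, and `↑(k − j) = k − j + p·[k < j]`). [folklore] -/
theorem summand_eq {n : ℕ} (x : ℝ) {t : Fin (n + 2) → ℝ} (ht : ∀ k, 0 < t k) (j : Fin (n + 2)) :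
    (∏ i ∈ Finset.univ.filter (fun i : Fin (n + 2) => i < j), t i) /
        ((∏ k, t k) ^ (1 / ((n:ℝ) + 2))) ^ (j:ℕ) * ∏ k, t k ^ (x + ((k:ℕ):ℝ) / ((n:ℝ) + 2) - 1) =
      t j ^ (x - 1) *
        ∏ i : Fin (n + 1), t (j + i.succ) ^ (x + (((i:ℕ):ℝ) + 1) / ((n:ℝ) + 2) - 1) := by
  -- the three factors of the left side as products of powers of the `t k`
  have h1 : (∏ i ∈ Finset.univ.filter (fun i : Fin (n + 2) => i < j), t i) =
      ∏ k, t k ^ (if k < j then (1:ℝ) else 0) := by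
    rw [Finset.prod_filter]
    refine Finset.prod_congr rfl fun k _ => ?_
    split_ifs <;> simp
  have h2 : ((∏ k, t k) ^ (1 / ((n:ℝ) + 2))) ^ (j:ℕ) = ∏ k, t k ^ (((j:ℕ):ℝ) / ((n:ℝ) + 2)) := by
    rw [← rpow_natCast, ← rpow_mul (Finset.prod_nonneg fun k _ => (ht k).le),
      show 1 / ((n:ℝ) + 2) * ((j:ℕ):ℝ) = ((j:ℕ):ℝ) / ((n:ℝ) + 2) by ring,
      ← Real.finsetProd_rpow Finset.univ t (fun k _ => (ht k).le)]
  -- the right side as one product over `Fin (n + 2)`, reindexed by `k ↦ j + k`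
  have h3 : t j ^ (x - 1) *
        ∏ i : Fin (n + 1), t (j + i.succ) ^ (x + (((i:ℕ):ℝ) + 1) / ((n:ℝ) + 2) - 1) =
      ∏ k : Fin (n + 2), t (j + k) ^ (x + ((k:ℕ):ℝ) / ((n:ℝ) + 2) - 1) := by
    conv_rhs => rw [Fin.prod_univ_succ]
    simp only [add_zero, Fin.val_zero, Nat.cast_zero, zero_div, Fin.val_succ, Nat.cast_succ]
  have h4 : ∏ k : Fin (n + 2), t (j + k) ^ (x + ((k:ℕ):ℝ) / ((n:ℝ) + 2) - 1) =
      ∏ k : Fin (n + 2), t k ^ (x + (((k - j : Fin (n + 2)):ℕ):ℝ) / ((n:ℝ) + 2) - 1) :=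
    Fintype.prod_equiv (Equiv.addLeft j) _ _ fun k => by simp
  rw [h1, h2, ← Finset.prod_div_distrib, ← Finset.prod_mul_distrib, h3, h4]
  refine Finset.prod_congr rfl fun k _ => ?_
  have hp : (n:ℝ) + 2 ≠ 0 := by positivity
  rw [← rpow_sub (ht k), ← rpow_add (ht k), natCast_val_sub]
  congr 1
  split_ifs <;> push_cast <;> field_simp <;> ring

/-- **The rotation-averaged shifted integrand without divisions**: for positive `t`,
`G t = (1/p)·(Σ_j t_j^(x−1) ∏_i t_{j+i+1}^(x+(i+1)/p−1))·∏_k (1 − t_k)^(s−1)`.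
[cite: AndrewsAskeyRoy1999, Thm 1.5.2] -/
theorem graph_apply {n : ℕ} (x s : ℚ) {G : (Fin (n + 2) → ℝ) → ℝ}
    (hG : ∀ t : Fin (n + 2) → ℝ, G t = (∑ j : Fin (n + 2), (∏ i ∈ Finset.univ.filter (fun i : Fin (n + 2) => i < j), t i) /
        ((∏ k, t k) ^ (1 / ((n:ℝ) + 2))) ^ (j:ℕ)) / ((n:ℝ) + 2) *
      ∏ k : Fin (n + 2), (t k) ^ ((x:ℝ) + ((k:ℕ):ℝ) / ((n:ℝ) + 2) - 1) * (1 - t k) ^ ((s:ℝ) - 1))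
    {t : Fin (n + 2) → ℝ} (ht : ∀ k, 0 < t k) :
    G t = 1 / ((n:ℝ) + 2) * (∑ j : Fin (n + 2), t j ^ ((x:ℝ) - 1) *
        ∏ i : Fin (n + 1), t (j + i.succ) ^ ((x:ℝ) + (((i:ℕ):ℝ) + 1) / ((n:ℝ) + 2) - 1)) *
      ∏ k, (1 - t k) ^ ((s:ℝ) - 1) := by
  rw [hG, Finset.prod_mul_distrib, ← Finset.sum_congr rfl fun j _ => summand_eq (x:ℝ) ht j,
    ← Finset.sum_mul]
  ring

/-- The barycentric weights sum to one: `Σ_k Θ u k = θ₀ + Σ_i θ_i = 1`. [folklore] -/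
theorem sum_theta {n : ℕ} {Θ : (Fin (n + 2) → ℝ) → Fin (n + 2) → ℝ}
    (hΘ0 : ∀ u, Θ u 0 = 1 - ∑ i : Fin (n + 1), u (Fin.castSucc i))
    (hΘs : ∀ u (i : Fin (n + 1)), Θ u i.succ = u (Fin.castSucc i)) (u : Fin (n + 2) → ℝ) :
    ∑ k, Θ u k = 1 := by
  rw [Fin.sum_univ_succ, hΘ0]
  simp only [hΘs]
  ring

/-- On the chart domain `U`: every barycentric weight is positive with `y·Θ_k < 1`, hence every
box coordinate `t_k = 1 − yΘ_k` lies in `(0,1)`. [folklore] -/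
theorem T_mem {n : ℕ} {Θ T : (Fin (n + 2) → ℝ) → Fin (n + 2) → ℝ}
    (hΘ0 : ∀ u, Θ u 0 = 1 - ∑ i : Fin (n + 1), u (Fin.castSucc i))
    (hΘs : ∀ u (i : Fin (n + 1)), Θ u i.succ = u (Fin.castSucc i))
    (hT : ∀ u k, T u k = 1 - u (Fin.last (n + 1)) * Θ u k) {u : Fin (n + 2) → ℝ}
    (hu : u ∈ {u : Fin (n + 2) → ℝ | (∀ i : Fin (n + 1), 0 < u (Fin.castSucc i)) ∧ ∑ i : Fin (n + 1), u (Fin.castSucc i) < 1 ∧ 0 < u (Fin.last (n + 1)) ∧ u (Fin.last (n + 1)) * (1 - ∑ i : Fin (n + 1), u (Fin.castSucc i)) < 1 ∧ ∀ i : Fin (n + 1), u (Fin.last (n + 1)) * u (Fin.castSucc i) < 1})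
    (k : Fin (n + 2)) :
    (0 < Θ u k ∧ u (Fin.last (n + 1)) * Θ u k < 1) ∧ (0 < T u k ∧ T u k < 1) := by
  obtain ⟨hpos, hsum, hy, h0, hi⟩ := hu
  have hk : 0 < Θ u k ∧ u (Fin.last (n + 1)) * Θ u k < 1 := by
    refine Fin.cases ?_ (fun i => ?_) k
    · rw [hΘ0]
      exact ⟨by linarith, h0⟩
    · rw [hΘs]
      exact ⟨hpos i, hi i⟩
  refine ⟨hk, ?_, ?_⟩
  · rw [hT]
    linarith [hk.2]
  · rw [hT]
    have := mul_pos hy hk.1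
    linarith

/-- **Vieta expansion of the box product**: `∏_k T u k = ∏_k (1 − yΘ_k) = 1 − y·S u` with the
polynomial `S u = Σ_{j<p} (−1)^j y^j e_{j+1}(Θ u)`. [folklore] -/
theorem prod_T_eq {n : ℕ} {Θ T : (Fin (n + 2) → ℝ) → Fin (n + 2) → ℝ} {S : (Fin (n + 2) → ℝ) → ℝ}
    (hT : ∀ u k, T u k = 1 - u (Fin.last (n + 1)) * Θ u k)
    (hS : ∀ u, S u = ∑ j ∈ Finset.range (n + 2), (-1:ℝ) ^ j * u (Fin.last (n + 1)) ^ j *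
      ∑ A ∈ Finset.powersetCard (j + 1) (Finset.univ : Finset (Fin (n + 2))), ∏ k ∈ A, Θ u k)
    (u : Fin (n + 2) → ℝ) : ∏ k, T u k = 1 - u (Fin.last (n + 1)) * S u := by
  set y := u (Fin.last (n + 1))
  have h1 : ∏ k, T u k = ∏ k, (1 + -y * Θ u k) :=
    Finset.prod_congr rfl fun k _ => by rw [hT]; ring
  have h2 : ∀ j : ℕ, ∑ A ∈ Finset.powersetCard (j + 1) (Finset.univ : Finset (Fin (n + 2))),
      ∏ k ∈ A, (-y * Θ u k) = (-1:ℝ) ^ j * y ^ j * (-y) *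
        ∑ A ∈ Finset.powersetCard (j + 1) (Finset.univ : Finset (Fin (n + 2))), ∏ k ∈ A, Θ u k := by
    intro j
    rw [Finset.mul_sum]
    refine Finset.sum_congr rfl fun A hA => ?_
    rw [Finset.prod_mul_distrib, Finset.prod_const, (Finset.mem_powersetCard.1 hA).2, pow_succ,
      neg_pow]
  rw [h1, Finset.prod_one_add, Finset.sum_powerset, Finset.card_univ, Fintype.card_fin,
    Finset.sum_range_succ', Finset.powersetCard_zero, Finset.sum_singleton, Finset.prod_empty, hS,
    Finset.mul_sum, add_comm, sub_eq_add_neg, ← Finset.sum_neg_distrib]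
  simp only [h2]
  congr 1
  refine Finset.sum_congr rfl fun j _ => ?_
  ring

/-- **`S > 0` and `H·(1 − Z) = y` on the chart domain**: `∏ t_k ∈ (0,1)`, `Z = (∏t)^(1/p) ∈ (0,1)`,
`y·S = 1 − ∏ t_k > 0`, and `(Σ_{j<p} Z^j)(1 − Z) = 1 − Z^p = 1 − ∏ t_k = y·S`.
[cite: KontsevichZagier2001, §1.2] -/
theorem S_pos_H {n : ℕ} {Θ T : (Fin (n + 2) → ℝ) → Fin (n + 2) → ℝ} {Z S H : (Fin (n + 2) → ℝ) → ℝ}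
    (hΘ0 : ∀ u, Θ u 0 = 1 - ∑ i : Fin (n + 1), u (Fin.castSucc i))
    (hΘs : ∀ u (i : Fin (n + 1)), Θ u i.succ = u (Fin.castSucc i))
    (hT : ∀ u k, T u k = 1 - u (Fin.last (n + 1)) * Θ u k)
    (hZ : ∀ u, Z u = (∏ k, T u k) ^ (1 / ((n:ℝ) + 2)))
    (hS : ∀ u, S u = ∑ j ∈ Finset.range (n + 2), (-1:ℝ) ^ j * u (Fin.last (n + 1)) ^ j *
      ∑ A ∈ Finset.powersetCard (j + 1) (Finset.univ : Finset (Fin (n + 2))), ∏ k ∈ A, Θ u k)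
    (hH : ∀ u, H u = (∑ j ∈ Finset.range (n + 2), Z u ^ j) / S u) {u : Fin (n + 2) → ℝ}
    (hu : u ∈ {u : Fin (n + 2) → ℝ | (∀ i : Fin (n + 1), 0 < u (Fin.castSucc i)) ∧ ∑ i : Fin (n + 1), u (Fin.castSucc i) < 1 ∧ 0 < u (Fin.last (n + 1)) ∧ u (Fin.last (n + 1)) * (1 - ∑ i : Fin (n + 1), u (Fin.castSucc i)) < 1 ∧ ∀ i : Fin (n + 1), u (Fin.last (n + 1)) * u (Fin.castSucc i) < 1}) :
    (0 < ∏ k, T u k ∧ ∏ k, T u k < 1) ∧ (0 < Z u ∧ Z u < 1) ∧ 0 < S u ∧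
      H u * (1 - Z u) = u (Fin.last (n + 1)) := by
  have ht := fun k => (T_mem hΘ0 hΘs hT hu k).2
  have hy : 0 < u (Fin.last (n + 1)) := hu.2.2.1
  have hP0 : 0 < ∏ k, T u k := Finset.prod_pos fun k _ => (ht k).1
  have hP1 : ∏ k, T u k < 1 := by
    rw [Fin.prod_univ_succ]
    calc T u 0 * ∏ i : Fin (n + 1), T u i.succ ≤ T u 0 * 1 := by
          gcongr
          · exact (ht 0).1.le
          · exact Finset.prod_le_one (fun i _ => (ht _).1.le) fun i _ => (ht _).2.le
      _ < 1 := by rw [mul_one]; exact (ht 0).2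
  have hyS : u (Fin.last (n + 1)) * S u = 1 - ∏ k, T u k := by
    rw [prod_T_eq hT hS u]
    ring
  have hSpos : 0 < S u := pos_of_mul_pos_right (by rw [hyS]; linarith) hy.le
  have hZp : Z u ^ (n + 2) = ∏ k, T u k := by
    rw [hZ, ← rpow_natCast, ← rpow_mul hP0.le,
      show 1 / ((n:ℝ) + 2) * ((n + 2 : ℕ) : ℝ) = 1 by push_cast; field_simp]
    exact rpow_one _
  refine ⟨⟨hP0, hP1⟩, ⟨by rw [hZ]; exact rpow_pos_of_pos hP0 _,
    by rw [hZ]; exact rpow_lt_one hP0.le hP1 (by positivity)⟩, hSpos, ?_⟩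
  rw [hH, div_mul_eq_mul_div, div_eq_iff hSpos.ne', geom_sum_mul_neg, hZp]
  exact hyS.symm

/-- `M u k / T u k = t_k^(x−1) ∏_i t_{k+i+1}^(x+(i+1)/p−1)` for `t_k ≠ 0` (one power of `t_k`
cancels). [folklore] -/
theorem M_div_T {n : ℕ} (x : ℚ) {T M : (Fin (n + 2) → ℝ) → Fin (n + 2) → ℝ}
    (hM : ∀ u k, M u k = (T u k) ^ (x:ℝ) * ∏ j : Fin (n + 1), (T u (k + j.succ)) ^ ((x:ℝ) + (((j:ℕ):ℝ) + 1) / ((n:ℝ) + 2) - 1))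
    {u : Fin (n + 2) → ℝ} {k : Fin (n + 2)} (hk : T u k ≠ 0) :
    M u k / T u k = (T u k) ^ ((x:ℝ) - 1) *
      ∏ j : Fin (n + 1), (T u (k + j.succ)) ^ ((x:ℝ) + (((j:ℕ):ℝ) + 1) / ((n:ℝ) + 2) - 1) := by
  rw [hM, rpow_sub_one hk]
  ring

/-- `∏_k (1 − T u k)^(s−1) = (y^(s−1))^p · (∏_k Θ u k)^(s−1)` on the chart domain
(`1 − t_k = yΘ_k` with `y, Θ_k ≥ 0`). [folklore] -/
theorem prod_one_sub_T_rpow {n : ℕ} (e : ℝ) {Θ T : (Fin (n + 2) → ℝ) → Fin (n + 2) → ℝ}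
    (hT : ∀ u k, T u k = 1 - u (Fin.last (n + 1)) * Θ u k) {u : Fin (n + 2) → ℝ}
    (hy : 0 ≤ u (Fin.last (n + 1))) (hΘ : ∀ k, 0 ≤ Θ u k) :
    ∏ k, (1 - T u k) ^ e = (u (Fin.last (n + 1)) ^ e) ^ (n + 2) * (∏ k, Θ u k) ^ e := by
  have hc : (u (Fin.last (n + 1)) ^ e) ^ (n + 2) = ∏ _k : Fin (n + 2), u (Fin.last (n + 1)) ^ e := by
    rw [Finset.prod_const, Finset.card_univ, Fintype.card_fin]
  rw [← Real.finsetProd_rpow Finset.univ _ (fun k _ => hΘ k), hc, ← Finset.prod_mul_distrib]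
  refine Finset.prod_congr rfl fun k _ => ?_
  rw [hT, sub_sub_cancel, mul_rpow hy (hΘ k)]

end CornerGraphGen

/-- **The division spelling of the graph density, dimension `p = n + 2`** (registered sub-goal
`cornerGraphSpellingGen`): on the chart domain `U`, with `t_k = T u k = 1 − yΘ_k`,
`G(T u)·y^(n+1) = (1/p)·y^(ps−1)·K u·Σ_k M u k/T u k`, `0 < S u` and `H u·(1 − Z u) = y`.
Pure `rpow` book-keeping (`CornerGraphGen.graph_apply`, `1 − t_k = yΘ_k`,
`(y^(s−1))^p·y^(n+1) = y^(ps−1)`) and the Vieta identity `y·S = 1 − Z^p`.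
[cite: KontsevichZagier2001, §1.2] -/
theorem cornerGraphSpellingGen : ∀ (n : ℕ) (x s : ℚ), 2 ≤ x → 3 ≤ s → ∀ (Θ T : (Fin (n + 2) → ℝ) → Fin (n + 2) → ℝ) (Z S H K : (Fin (n + 2) → ℝ) → ℝ)
      (M : (Fin (n + 2) → ℝ) → Fin (n + 2) → ℝ) (P : (Fin (n + 3) → ℝ) → ℝ),
    (∀ u, Θ u 0 = 1 - ∑ i : Fin (n + 1), u (Fin.castSucc i)) → (∀ u (i : Fin (n + 1)), Θ u i.succ = u (Fin.castSucc i)) →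
    (∀ u k, T u k = 1 - u (Fin.last (n + 1)) * Θ u k) →
    (∀ u, Z u = (∏ k, T u k) ^ (1 / ((n:ℝ) + 2))) →
    (∀ u, S u = ∑ j ∈ Finset.range (n + 2), (-1:ℝ) ^ j * u (Fin.last (n + 1)) ^ j *
      ∑ A ∈ Finset.powersetCard (j + 1) (Finset.univ : Finset (Fin (n + 2))), ∏ k ∈ A, Θ u k) →
    (∀ u, H u = (∑ j ∈ Finset.range (n + 2), Z u ^ j) / S u) →
    (∀ u, K u = (∏ k, Θ u k) ^ ((s:ℝ) - 1)) →
    (∀ u k, M u k = (T u k) ^ (x:ℝ) * ∏ j : Fin (n + 1), (T u (k + j.succ)) ^ ((x:ℝ) + (((j:ℕ):ℝ) + 1) / ((n:ℝ) + 2) - 1)) →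
    (∀ w, P w = (w (Fin.last (n + 2))) ^ (((n:ℝ) + 2) * (x:ℝ) - 1) *
      (1 - w (Fin.last (n + 2)) * Z (Fin.init w)) ^ (((n:ℝ) + 2) * (s:ℝ) - 1) * H (Fin.init w) ^ (((n:ℝ) + 2) * (s:ℝ)) * K (Fin.init w)) →
    ∀ (G : (Fin (n + 2) → ℝ) → ℝ), (∀ t : Fin (n + 2) → ℝ, G t = (∑ j : Fin (n + 2), (∏ i ∈ Finset.univ.filter (fun i : Fin (n + 2) => i < j), t i) /
        ((∏ k, t k) ^ (1 / ((n:ℝ) + 2))) ^ (j:ℕ)) / ((n:ℝ) + 2) *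
      ∏ k : Fin (n + 2), (t k) ^ ((x:ℝ) + ((k:ℕ):ℝ) / ((n:ℝ) + 2) - 1) * (1 - t k) ^ ((s:ℝ) - 1)) →
    ∀ u ∈ {u : Fin (n + 2) → ℝ | (∀ i : Fin (n + 1), 0 < u (Fin.castSucc i)) ∧ ∑ i : Fin (n + 1), u (Fin.castSucc i) < 1 ∧ 0 < u (Fin.last (n + 1)) ∧ u (Fin.last (n + 1)) * (1 - ∑ i : Fin (n + 1), u (Fin.castSucc i)) < 1 ∧ ∀ i : Fin (n + 1), u (Fin.last (n + 1)) * u (Fin.castSucc i) < 1},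
      G (T u) * (u (Fin.last (n + 1))) ^ (n + 1) =
        1 / ((n:ℝ) + 2) * (u (Fin.last (n + 1))) ^ (((n:ℝ) + 2) * (s:ℝ) - 1) * K u * ∑ k, M u k / T u k ∧
      0 < S u ∧ H u * (1 - Z u) = u (Fin.last (n + 1)) := by
  intro n x s _ _ Θ T Z S H K M P hΘ0 hΘs hT hZ hS hH hK hM _ G hG u hu
  obtain ⟨-, -, hSpos, hHy⟩ := CornerGraphGen.S_pos_H hΘ0 hΘs hT hZ hS hH hu
  refine ⟨?_, hSpos, hHy⟩
  have hmem := CornerGraphGen.T_mem hΘ0 hΘs hT hu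
  have hy : 0 < u (Fin.last (n + 1)) := hu.2.2.1
  have hypow : (u (Fin.last (n + 1)) ^ ((s:ℝ) - 1)) ^ (n + 2) * u (Fin.last (n + 1)) ^ (n + 1) =
      u (Fin.last (n + 1)) ^ (((n:ℝ) + 2) * (s:ℝ) - 1) := by
    rw [← rpow_natCast, ← rpow_natCast, ← rpow_mul hy.le, ← rpow_add hy]
    congr 1
    push_cast
    ring
  rw [CornerGraphGen.graph_apply x s hG fun k => (hmem k).2.1,
    Finset.sum_congr rfl fun k _ => CornerGraphGen.M_div_T x hM (hmem k).2.1.ne',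
    CornerGraphGen.prod_one_sub_T_rpow ((s:ℝ) - 1) hT hy.le fun k => (hmem k).1.1.le, hK, ← hypow]
  ring

end Summit.KontsevichZagierPeriods.TerasomaMultiplication.MultiplicationAccessible

end
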